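import Mathlib.Analysis.SpecialFunctions.Log.Deriv
import Mathlib.Analysis.SpecialFunctions.Log.NegMulLog
import Mathlib.Analysis.SpecialFunctions.Sqrt
import Mathlib.Analysis.SpecialFunctions.Pow.Real
import Mathlib.Analysis.Calculus.MeanValue
import Mathlib.Analysis.Calculus.IteratedDeriv.Defs
import Mathlib.Analysis.Convex.Deriv
import Mathlib.LinearAlgebra.Matrix.PosDef
import HarnessLib

/-!
# Self-concordant functions (Nesterov–Nemirovski): the one-dimensional theory

A convex function `f : ℝ → ℝ` is *self-concordant* if `|f'''(x)| ≤ 2 f''(x)^{3/2}` on its (open)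
domain [BoydVandenberghe2004, §9.6.1, (9.41)]; a function of several variables is self-concordant
if it is self-concordant along every line [BoydVandenberghe2004, §9.6.1; JarreVavasis2009, §32.5,
(32.63)]. Self-concordance is the regularity hypothesis under which Nesterov and Nemirovski's
analysis of Newton's method and of barrier (interior-point) methods — in particular the ones used
by semidefinite-programming solvers — goes through [NesterovNemirovskii1994; BoydVandenberghe2004,
§9.6, §11.5; JarreVavasis2009, §32.4–32.6].

This file sets up the one-dimensional notion with explicit derivative witnesses and proves the
elementary part of the theory, following Boyd–Vandenberghe §9.6.1–9.6.3 (pp. 496 ff.):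

* `SelfConcordantWith s f f₁ f₂ f₃` / `SelfConcordantOn s f` — the definition on an open set `s ⊆
  ℝ` (pointwise `HasDerivAt` witnesses, `f'' ≥ 0`, and (9.41) in the form `|f₃| ≤ 2 · (f₂ ·
  √f₂)`, using `f''^{3/2} = f''·√f''`);
  `SelfConcordantOn.abs_iteratedDeriv_three_le` is (9.41) verbatim in Mathlib's `iteratedDeriv`
  notation, `SelfConcordantOn.of_deriv` the converse packaging, `SelfConcordantWith.convexOn`
  convexity on an open interval.
* Examples [BoydVandenberghe2004, §9.6.1, Example 9.3]: affine and convex quadratic functions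
  (`selfConcordantWith_affine`, `selfConcordantWith_quadratic`), the negative logarithm on `(0,
  ∞)` with *equality* in (9.41) (`selfConcordantWith_neg_log`, `neg_log_selfConcordance_eq`), and
  negative entropy plus negative logarithm `x log x - log x`
  (`selfConcordantWith_mul_log_sub_log`).
* Self-concordant calculus [BoydVandenberghe2004, §9.6.2]: scaling by `a ≥ 1`
  (`SelfConcordantWith.const_mul`), sums (`add`, `add_inter`, `sum`; the inequality `u√u + v√v ≤
  (u+v)√(u+v)` is `mul_sqrt_add_mul_sqrt_le`), composition with an affine map of the line
  (`comp_affine`, derivatives `a f'`, `a² f''`, `a³ f'''`), and the general-constant rescaling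
  (9.42) (`selfConcordantWith_const_mul_of_abs_le`: `|f'''| ≤ k f''^{3/2}` makes `(k²/4) f`
  self-concordant).
* The logarithmic barrier [BoydVandenberghe2004, Example 9.4; JarreVavasis2009, (32.64)]: `t ↦ -∑
  log (bᵢ - aᵢ t)` is self-concordant (`selfConcordantOn_logBarrier`); with `LineSelfConcordantOn
  D F` (self-concordance of `F : E → ℝ` along every line of `D ⊆ E`) the log barrier `x ↦ -∑ log
  (bᵢ - aᵢ(x))` of an open polyhedron (`lineSelfConcordantOn_logBarrier`, linear functionals `aᵢ`)
  and the orthant barrier `-∑ log xᵢ` (`lineSelfConcordantOn_negSumLog_orthant`) are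
  self-concordant along lines.
* Bounds on the second derivative [BoydVandenberghe2004, §9.6.3, (9.45)–(9.46)]: where `f'' > 0`,
  `τ ↦ f''(τ)^{-1/2}` has derivative `-f'''/(2 f''^{3/2})` of absolute value `≤ 1`
  (`hasDerivAt_inv_sqrt`, `abs_deriv_inv_sqrt_le_one`), hence on a segment `[t₀, t₁]` of the
  domain `|f''(t₁)^{-1/2} - f''(t₀)^{-1/2}| ≤ t₁ - t₀` (`abs_inv_sqrt_sub_inv_sqrt_le`) and the
  two-sided bound (9.46) `f''(t₀)/(1 + (t₁-t₀) f''(t₀)^{1/2})² ≤ f''(t₁) ≤ f''(t₀)/(1 - (t₁-t₀)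
  f''(t₀)^{1/2})²` (`deriv2_lower_bound`; `deriv2_upper_bound` for `(t₁ - t₀) f''(t₀)^{1/2} < 1`).
* Statement only (named `Prop`, no proof claimed): `NegLogDetLineSelfConcordant n` — the
  log-determinant barrier `-log det X` is self-concordant along lines of the positive definite
  cone [BoydVandenberghe2004, Example 9.5; JarreVavasis2009, §32.6 ("we omit the proof; see
  Nesterov and Nemirovskii"); NesterovNemirovskii1994].

## Not formalised here

The barrier *parameter* (Jarre–Vavasis (32.28), `θ = n` for the orthant and for `-log det`,
(32.65)–(32.66)), the finite-difference conditions (32.24)/(32.26), the Newton-decrement and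
suboptimality bounds (9.47)–(9.48) and the complexity analysis of Newton's method
[BoydVandenberghe2004, §9.6.4] are not formalised; neither is the eigenvalue reduction proving
Example 9.5 (only its statement is recorded, as `NegLogDetLineSelfConcordant`).

## References

* [BoydVandenberghe2004] S. Boyd, L. Vandenberghe, *Convex Optimization*, Cambridge University
  Press 2004 — §9.6.1 (definition (9.41), rescaling (9.42), affine invariance, Examples 9.3–9.5),
  §9.6.2 (self-concordant calculus: scaling and sum, composition), §9.6.3 ((9.45), (9.46)),
  bibliography of Ch. 9 (attribution to [NN94]).
* [JarreVavasis2009] F. Jarre, S. Vavasis, *Convex Optimization*, Ch. 32 of *Algorithms and Theory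
  of Computation Handbook*, 2nd ed., Chapman & Hall/CRC 2009, doi:10.1201/9781584888239-c32 —
  §32.5 ((32.63) differential self-concordance condition, (32.62) ball barrier, (32.64)–(32.66)
  orthant barrier), §32.6 (`-ln det` is a self-concordant barrier with parameter `n`).
* [NesterovNemirovskii1994] Yu. Nesterov, A. Nemirovskii, *Interior-Point Polynomial Algorithms in
  Convex Programming*, SIAM 1994, doi:10.1137/1.9781611970791 (origin of the notion).

Engines note (eng-sdp-2, certsdp lane): anchor for the barrier/interior-point vocabulary behind
the floating-point SDP solvers whose outputs the certsdp verifiers certify; shared numerical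
engines serving client cells — rigour lives in the verifiers; every published number belongs to a
client cell's ledger, not to the engines group. Dedup searches run before writing (2026-08-24):
`lean search 'self-concordan|selfConcordant|SelfConcordant'` (no hits in Mathlib, Literature,
Summits, HarnessLib), `ls Literature/Analysis/Convex/` (no barrier/self-concordance file).
-/

open Real Set Filter
open scoped Topology

namespace Literature.Analysis.Convex.SelfConcordant

/-! ## Definition (Boyd–Vandenberghe (9.41); Jarre–Vavasis (32.63) along a line) -/

/-- `SelfConcordantWith s f f₁ f₂ f₃`: on the open set `s ⊆ ℝ` the function `f` has first, second
and third derivatives `f₁, f₂, f₃` (pointwise `HasDerivAt` witnesses), `f'' ≥ 0` there, and the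
self-concordance inequality `|f'''(x)| ≤ 2 f''(x)^{3/2}` holds, written as
`|f₃ x| ≤ 2 · (f₂ x · √(f₂ x))`. [cite: BoydVandenberghe2004, §9.6.1 (9.41)] -/
structure SelfConcordantWith (s : Set ℝ) (f f₁ f₂ f₃ : ℝ → ℝ) : Prop where
  isOpen : IsOpen s
  hasDerivAt₁ : ∀ x ∈ s, HasDerivAt f (f₁ x) x
  hasDerivAt₂ : ∀ x ∈ s, HasDerivAt f₁ (f₂ x) x
  hasDerivAt₃ : ∀ x ∈ s, HasDerivAt f₂ (f₃ x) x
  nonneg : ∀ x ∈ s, 0 ≤ f₂ x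
  abs_le : ∀ x ∈ s, |f₃ x| ≤ 2 * (f₂ x * Real.sqrt (f₂ x))

/-- `f` is self-concordant on the open set `s ⊆ ℝ` (Boyd–Vandenberghe (9.41)): it admits
derivative witnesses as in `SelfConcordantWith`. [cite: BoydVandenberghe2004, §9.6.1 (9.41)] -/
def SelfConcordantOn (s : Set ℝ) (f : ℝ → ℝ) : Prop :=
  ∃ f₁ f₂ f₃ : ℝ → ℝ, SelfConcordantWith s f f₁ f₂ f₃

namespace SelfConcordantWith

variable {s t : Set ℝ} {f f₁ f₂ f₃ g g₁ g₂ g₃ : ℝ → ℝ} {x : ℝ}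

/-- Forget the witnesses.
[cite: BoydVandenberghe2004, §9.6.1 (9.41) (plumbing for the definition)] -/
theorem selfConcordantOn (h : SelfConcordantWith s f f₁ f₂ f₃) : SelfConcordantOn s f :=
  ⟨f₁, f₂, f₃, h⟩

/-- The defining inequality in the `rpow` form `|f'''| ≤ 2 (f'')^{3/2}`.
[cite: BoydVandenberghe2004, §9.6.1 (9.41)] -/
theorem abs_le_rpow (h : SelfConcordantWith s f f₁ f₂ f₃) (hx : x ∈ s) :
    |f₃ x| ≤ 2 * f₂ x ^ ((3 : ℝ) / 2) := by
  have e : f₂ x ^ ((3 : ℝ) / 2) = f₂ x * Real.sqrt (f₂ x) := by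
    rw [Real.sqrt_eq_rpow, ← Real.rpow_one_add' (h.nonneg x hx) (by norm_num)]; norm_num
  rw [e]
  exact h.abs_le x hx

/-- Restriction to an open subset.
[cite: BoydVandenberghe2004, §9.6.1 (9.41) (plumbing for the definition)] -/
theorem mono (h : SelfConcordantWith s f f₁ f₂ f₃) (ht : IsOpen t) (hts : t ⊆ s) :
    SelfConcordantWith t f f₁ f₂ f₃ where
  isOpen := ht
  hasDerivAt₁ x hx := h.hasDerivAt₁ x (hts hx)
  hasDerivAt₂ x hx := h.hasDerivAt₂ x (hts hx)
  hasDerivAt₃ x hx := h.hasDerivAt₃ x (hts hx)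
  nonneg x hx := h.nonneg x (hts hx)
  abs_le x hx := h.abs_le x (hts hx)

/-- Change of witnesses agreeing on `s`.
[cite: BoydVandenberghe2004, §9.6.1 (9.41) (plumbing for the definition)] -/
theorem congr (h : SelfConcordantWith s f f₁ f₂ f₃) (hf : EqOn f g s) (h₁ : EqOn f₁ g₁ s)
    (h₂ : EqOn f₂ g₂ s) (h₃ : EqOn f₃ g₃ s) : SelfConcordantWith s g g₁ g₂ g₃ where
  isOpen := h.isOpen
  hasDerivAt₁ x hx := by
    rw [← h₁ hx]
    exact (h.hasDerivAt₁ x hx).congr_of_eventuallyEq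
      ((h.isOpen.eventually_mem hx).mono fun y hy => (hf hy).symm)
  hasDerivAt₂ x hx := by
    rw [← h₂ hx]
    exact (h.hasDerivAt₂ x hx).congr_of_eventuallyEq
      ((h.isOpen.eventually_mem hx).mono fun y hy => (h₁ hy).symm)
  hasDerivAt₃ x hx := by
    rw [← h₃ hx]
    exact (h.hasDerivAt₃ x hx).congr_of_eventuallyEq
      ((h.isOpen.eventually_mem hx).mono fun y hy => (h₂ hy).symm)
  nonneg x hx := h₂ hx ▸ h.nonneg x hx
  abs_le x hx := by rw [← h₂ hx, ← h₃ hx]; exact h.abs_le x hx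

/-! ### The witnesses are the derivatives -/

/-- `deriv f = f₁` on `s`.
[cite: BoydVandenberghe2004, §9.6.1 (9.41) (plumbing for the definition)] -/
theorem deriv_eq (h : SelfConcordantWith s f f₁ f₂ f₃) (hx : x ∈ s) : deriv f x = f₁ x :=
  (h.hasDerivAt₁ x hx).deriv

/-- Near a point of the open set `s`, `deriv f` agrees with the witness `f₁`.
[cite: BoydVandenberghe2004, §9.6.1 (9.41) (plumbing for the definition)] -/
theorem deriv_eventuallyEq (h : SelfConcordantWith s f f₁ f₂ f₃) (hx : x ∈ s) :
    deriv f =ᶠ[𝓝 x] f₁ :=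
  (h.isOpen.eventually_mem hx).mono fun _ hy => h.deriv_eq hy

/-- `deriv f` has derivative `f₂` on `s`.
[cite: BoydVandenberghe2004, §9.6.1 (9.41) (plumbing for the definition)] -/
theorem hasDerivAt_deriv (h : SelfConcordantWith s f f₁ f₂ f₃) (hx : x ∈ s) :
    HasDerivAt (deriv f) (f₂ x) x :=
  (h.hasDerivAt₂ x hx).congr_of_eventuallyEq (h.deriv_eventuallyEq hx)

/-- `deriv (deriv f) = f₂` on `s`.
[cite: BoydVandenberghe2004, §9.6.1 (9.41) (plumbing for the definition)] -/
theorem deriv_deriv_eq (h : SelfConcordantWith s f f₁ f₂ f₃) (hx : x ∈ s) :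
    deriv (deriv f) x = f₂ x :=
  (h.hasDerivAt_deriv hx).deriv

/-- Near a point of `s`, `deriv (deriv f)` agrees with the witness `f₂`.
[cite: BoydVandenberghe2004, §9.6.1 (9.41) (plumbing for the definition)] -/
theorem deriv_deriv_eventuallyEq (h : SelfConcordantWith s f f₁ f₂ f₃) (hx : x ∈ s) :
    deriv (deriv f) =ᶠ[𝓝 x] f₂ :=
  (h.isOpen.eventually_mem hx).mono fun _ hy => h.deriv_deriv_eq hy

/-- `deriv (deriv f)` has derivative `f₃` on `s`.
[cite: BoydVandenberghe2004, §9.6.1 (9.41) (plumbing for the definition)] -/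
theorem hasDerivAt_deriv_deriv (h : SelfConcordantWith s f f₁ f₂ f₃) (hx : x ∈ s) :
    HasDerivAt (deriv (deriv f)) (f₃ x) x :=
  (h.hasDerivAt₃ x hx).congr_of_eventuallyEq (h.deriv_deriv_eventuallyEq hx)

/-- `f'' = f₂` on `s` in Mathlib's `iteratedDeriv` notation.
[cite: BoydVandenberghe2004, §9.6.1 (9.41) (plumbing for the definition)] -/
theorem iteratedDeriv_two_eq (h : SelfConcordantWith s f f₁ f₂ f₃) (hx : x ∈ s) :
    iteratedDeriv 2 f x = f₂ x := by
  rw [show (2 : ℕ) = 1 + 1 from rfl, iteratedDeriv_succ, iteratedDeriv_one]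
  exact h.deriv_deriv_eq hx

/-- `f''' = f₃` on `s` in Mathlib's `iteratedDeriv` notation.
[cite: BoydVandenberghe2004, §9.6.1 (9.41) (plumbing for the definition)] -/
theorem iteratedDeriv_three_eq (h : SelfConcordantWith s f f₁ f₂ f₃) (hx : x ∈ s) :
    iteratedDeriv 3 f x = f₃ x := by
  rw [show (3 : ℕ) = 1 + 1 + 1 from rfl, iteratedDeriv_succ, iteratedDeriv_succ, iteratedDeriv_one]
  exact (h.hasDerivAt_deriv_deriv hx).deriv

/-- A self-concordant function on an open *convex* set (an open interval) is convex there, as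
Boyd–Vandenberghe require in the definition (`f'' ≥ 0`). [cite: BoydVandenberghe2004, §9.6.1] -/
theorem convexOn (h : SelfConcordantWith s f f₁ f₂ f₃) (hs : Convex ℝ s) : ConvexOn ℝ s f := by
  have hint : interior s = s := h.isOpen.interior_eq
  refine convexOn_of_hasDerivWithinAt2_nonneg hs (f' := f₁) (f'' := f₂)
    (fun x hx => (h.hasDerivAt₁ x hx).continuousAt.continuousWithinAt) ?_ ?_ ?_
  · intro x hx; rw [hint] at hx ⊢; exact (h.hasDerivAt₁ x hx).hasDerivWithinAt
  · intro x hx; rw [hint] at hx ⊢; exact (h.hasDerivAt₂ x hx).hasDerivWithinAt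
  · intro x hx; rw [hint] at hx; exact h.nonneg x hx

end SelfConcordantWith

/-! ### Boyd–Vandenberghe (9.41) in Mathlib's notation, and the converse packaging -/

namespace SelfConcordantOn

variable {s : Set ℝ} {f : ℝ → ℝ} {x : ℝ}

/-- The domain of a self-concordant function (in this file's sense) is open.
[cite: BoydVandenberghe2004, §9.6.1] -/
theorem isOpen (h : SelfConcordantOn s f) : IsOpen s := by
  obtain ⟨_, _, _, h⟩ := h; exact h.isOpen

/-- **Boyd–Vandenberghe (9.41).** `|f'''(x)| ≤ 2 f''(x)^{3/2}` on `s`.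
[cite: BoydVandenberghe2004, §9.6.1 (9.41)] -/
theorem abs_iteratedDeriv_three_le (h : SelfConcordantOn s f) (hx : x ∈ s) :
    |iteratedDeriv 3 f x| ≤ 2 * iteratedDeriv 2 f x ^ ((3 : ℝ) / 2) := by
  obtain ⟨f₁, f₂, f₃, h⟩ := h
  rw [h.iteratedDeriv_three_eq hx, h.iteratedDeriv_two_eq hx]
  exact h.abs_le_rpow hx

/-- `f'' ≥ 0` on `s`. [cite: BoydVandenberghe2004, §9.6.1] -/
theorem iteratedDeriv_two_nonneg (h : SelfConcordantOn s f) (hx : x ∈ s) :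
    0 ≤ iteratedDeriv 2 f x := by
  obtain ⟨f₁, f₂, f₃, h⟩ := h
  rw [h.iteratedDeriv_two_eq hx]; exact h.nonneg x hx

/-- A self-concordant function on an open interval is convex there.
[cite: BoydVandenberghe2004, §9.6.1] -/
theorem convexOn (h : SelfConcordantOn s f) (hs : Convex ℝ s) : ConvexOn ℝ s f := by
  obtain ⟨_, _, _, h⟩ := h; exact h.convexOn hs

/-- Restriction to an open subset.
[cite: BoydVandenberghe2004, §9.6.1 (9.41) (plumbing for the definition)] -/
theorem mono {t : Set ℝ} (h : SelfConcordantOn s f) (ht : IsOpen t) (hts : t ⊆ s) :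
    SelfConcordantOn t f := by
  obtain ⟨f₁, f₂, f₃, h⟩ := h; exact ⟨f₁, f₂, f₃, h.mono ht hts⟩

/-- Packaging from Mathlib's own derivatives: a three times differentiable function on an open set
with `f'' ≥ 0` and `|f'''| ≤ 2 (f'')^{3/2}` is self-concordant.
[cite: BoydVandenberghe2004, §9.6.1] -/
theorem of_deriv (hs : IsOpen s) (h₁ : ∀ x ∈ s, DifferentiableAt ℝ f x)
    (h₂ : ∀ x ∈ s, DifferentiableAt ℝ (deriv f) x)
    (h₃ : ∀ x ∈ s, DifferentiableAt ℝ (deriv (deriv f)) x)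
    (h0 : ∀ x ∈ s, 0 ≤ iteratedDeriv 2 f x)
    (h : ∀ x ∈ s, |iteratedDeriv 3 f x| ≤ 2 * iteratedDeriv 2 f x ^ ((3 : ℝ) / 2)) :
    SelfConcordantOn s f := by
  have e2 : iteratedDeriv 2 f = deriv (deriv f) := by
    rw [show (2 : ℕ) = 1 + 1 from rfl, iteratedDeriv_succ, iteratedDeriv_one]
  have e3 : iteratedDeriv 3 f = deriv (deriv (deriv f)) := by
    rw [show (3 : ℕ) = 1 + 1 + 1 from rfl, iteratedDeriv_succ, iteratedDeriv_succ,
      iteratedDeriv_one]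
  refine ⟨deriv f, deriv (deriv f), deriv (deriv (deriv f)), ?_⟩
  exact
    { isOpen := hs
      hasDerivAt₁ := fun x hx => (h₁ x hx).hasDerivAt
      hasDerivAt₂ := fun x hx => (h₂ x hx).hasDerivAt
      hasDerivAt₃ := fun x hx => (h₃ x hx).hasDerivAt
      nonneg := fun x hx => by simpa [e2] using h0 x hx
      abs_le := fun x hx => by
        have := h x hx
        rw [e2, e3] at this
        have h0' : 0 ≤ deriv (deriv f) x := by simpa [e2] using h0 x hx
        have e : deriv (deriv f) x ^ ((3 : ℝ) / 2) =
            deriv (deriv f) x * Real.sqrt (deriv (deriv f) x) := by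
          rw [Real.sqrt_eq_rpow, ← Real.rpow_one_add' h0' (by norm_num)]; norm_num
        rwa [e] at this }

end SelfConcordantOn

/-! ## Examples (Boyd–Vandenberghe §9.6.1) -/

section Examples

variable {s : Set ℝ}

/-- Affine functions are self-concordant (zero third derivative).
[cite: BoydVandenberghe2004, §9.6.1, remark after (9.41)] -/
theorem selfConcordantWith_affine (hs : IsOpen s) (a b : ℝ) :
    SelfConcordantWith s (fun x => a * x + b) (fun _ => a) (fun _ => 0) (fun _ => 0) where
  isOpen := hs
  hasDerivAt₁ x _ := (((hasDerivAt_id x).const_mul a).add_const b).congr_deriv (by simp)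
  hasDerivAt₂ x _ := hasDerivAt_const x a
  hasDerivAt₃ x _ := hasDerivAt_const x 0
  nonneg _ _ := le_rfl
  abs_le _ _ := by simp

/-- Constant functions are self-concordant. [cite: BoydVandenberghe2004, §9.6.1] -/
theorem selfConcordantWith_const (hs : IsOpen s) (c : ℝ) :
    SelfConcordantWith s (fun _ => c) (fun _ => 0) (fun _ => 0) (fun _ => 0) where
  isOpen := hs
  hasDerivAt₁ x _ := hasDerivAt_const x c
  hasDerivAt₂ x _ := hasDerivAt_const x 0
  hasDerivAt₃ x _ := hasDerivAt_const x 0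
  nonneg _ _ := le_rfl
  abs_le _ _ := by simp

/-- Convex quadratics are self-concordant (zero third derivative).
[cite: BoydVandenberghe2004, §9.6.1, remark after (9.41)] -/
theorem selfConcordantWith_quadratic (hs : IsOpen s) {p : ℝ} (hp : 0 ≤ p) (q r : ℝ) :
    SelfConcordantWith s (fun x => p * x ^ 2 + q * x + r) (fun x => 2 * p * x + q)
      (fun _ => 2 * p) (fun _ => 0) where
  isOpen := hs
  hasDerivAt₁ x _ :=
    ((((hasDerivAt_pow 2 x).const_mul p).add ((hasDerivAt_id x).const_mul q)).add_const r
      ).congr_deriv (by simp; ring)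
  hasDerivAt₂ x _ := (((hasDerivAt_id x).const_mul (2 * p)).add_const q).congr_deriv (by simp)
  hasDerivAt₃ x _ := hasDerivAt_const x _
  nonneg _ _ := by positivity
  abs_le _ _ := by simp; positivity

/-- The algebra behind Example 9.3: for `x > 0`, `|-2/x³| = 2 · (x⁻² · √(x⁻²))`, i.e. the
self-concordance inequality (9.41) holds with *equality* for `-log`.
[cite: BoydVandenberghe2004, Example 9.3] -/
theorem neg_log_selfConcordance_eq {x : ℝ} (hx : 0 < x) :
    |(-2 / x ^ 3 : ℝ)| = 2 * ((x ^ 2)⁻¹ * Real.sqrt ((x ^ 2)⁻¹)) := by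
  rw [Real.sqrt_inv, Real.sqrt_sq hx.le, ← mul_inv, ← pow_succ, abs_div, abs_neg, abs_two,
    abs_of_pos (pow_pos hx 3), div_eq_mul_inv]

/-- **Boyd–Vandenberghe Example 9.3 (negative logarithm).** `f(x) = -log x` on `(0, ∞)` is
self-concordant, with `f' = -1/x`, `f'' = 1/x^2`, `f''' = -2/x^3`.
[cite: BoydVandenberghe2004, Example 9.3] -/
theorem selfConcordantWith_neg_log :
    SelfConcordantWith (Ioi 0) (fun x => -Real.log x) (fun x => -x⁻¹) (fun x => (x ^ 2)⁻¹)
      (fun x => -2 / x ^ 3) where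
  isOpen := isOpen_Ioi
  hasDerivAt₁ x hx := (Real.hasDerivAt_log (ne_of_gt hx)).neg
  hasDerivAt₂ x hx := by
    have hx0 : x ≠ 0 := ne_of_gt hx
    exact (hasDerivAt_inv hx0).neg.congr_deriv (by ring)
  hasDerivAt₃ x hx := by
    have hx0 : x ≠ 0 := ne_of_gt hx
    refine ((hasDerivAt_pow 2 x).inv (pow_ne_zero 2 hx0)).congr_deriv ?_
    simp only [Nat.cast_ofNat, Nat.add_one_sub_one, pow_one]
    field_simp
  nonneg x _ := by positivity
  abs_le x hx := (neg_log_selfConcordance_eq hx).le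

/-- `-log` is self-concordant on `(0, ∞)`. [cite: BoydVandenberghe2004, Example 9.3] -/
theorem selfConcordantOn_neg_log : SelfConcordantOn (Ioi 0) fun x => -Real.log x :=
  selfConcordantWith_neg_log.selfConcordantOn

/-- **Boyd–Vandenberghe Example 9.3 (negative entropy plus negative logarithm).**
`f(x) = x log x - log x` on `(0, ∞)` is self-concordant: `f'' = 1/x + 1/x^2 = (x+1)/x^2`,
`f''' = -1/x^2 - 2/x^3 = -(x+2)/x^3`, and `x + 2 ≤ 2 (x+1)^{3/2}`.
[cite: BoydVandenberghe2004, Example 9.3] -/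
theorem selfConcordantWith_mul_log_sub_log :
    SelfConcordantWith (Ioi 0) (fun x => x * Real.log x - Real.log x)
      (fun x => Real.log x + 1 - x⁻¹) (fun x => x⁻¹ + (x ^ 2)⁻¹)
      (fun x => -(x ^ 2)⁻¹ + -2 / x ^ 3) where
  isOpen := isOpen_Ioi
  hasDerivAt₁ x hx := by
    have hx0 : x ≠ 0 := ne_of_gt hx
    exact (Real.hasDerivAt_mul_log hx0).sub (Real.hasDerivAt_log hx0)
  hasDerivAt₂ x hx := by
    have hx0 : x ≠ 0 := ne_of_gt hx
    exact (((Real.hasDerivAt_log hx0).add_const 1).sub (hasDerivAt_inv hx0)).congr_deriv (by ring)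
  hasDerivAt₃ x hx := by
    have hx0 : x ≠ 0 := ne_of_gt hx
    refine ((hasDerivAt_inv hx0).add ((hasDerivAt_pow 2 x).inv (pow_ne_zero 2 hx0))).congr_deriv ?_
    simp only [Nat.cast_ofNat, Nat.add_one_sub_one, pow_one]
    field_simp
  nonneg x hx := by have : 0 < x := hx; positivity
  abs_le x hx := by
    have hx' : 0 < x := hx
    have e2 : x⁻¹ + (x ^ 2)⁻¹ = (x + 1) / x ^ 2 := by field_simp
    have e3 : -(x ^ 2)⁻¹ + -2 / x ^ 3 = -((x + 2) / x ^ 3) := by field_simp; ring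
    have hsq : Real.sqrt ((x + 1) / x ^ 2) = Real.sqrt (x + 1) / x := by
      rw [Real.sqrt_div' _ (sq_nonneg x), Real.sqrt_sq hx'.le]
    rw [e2, e3, abs_neg, abs_of_pos (by positivity), hsq]
    have h1 : 1 ≤ Real.sqrt (x + 1) := Real.one_le_sqrt.mpr (by linarith)
    rw [div_le_iff₀ (by positivity)]
    calc x + 2 ≤ 2 * (x + 1) * 1 := by linarith
      _ ≤ 2 * (x + 1) * Real.sqrt (x + 1) := by gcongr
      _ = 2 * ((x + 1) / x ^ 2 * (Real.sqrt (x + 1) / x)) * x ^ 3 := by field_simp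

/-- `x log x - log x` is self-concordant on `(0, ∞)`. [cite: BoydVandenberghe2004, Example 9.3] -/
theorem selfConcordantOn_mul_log_sub_log :
    SelfConcordantOn (Ioi 0) fun x => x * Real.log x - Real.log x :=
  selfConcordantWith_mul_log_sub_log.selfConcordantOn

end Examples

/-! ## Self-concordant calculus (Boyd–Vandenberghe §9.6.2) -/

/-- The elementary inequality behind the sum rule: `u√u + v√v ≤ (u+v)√(u+v)` for `u, v ≥ 0`,
i.e. `(u^{3/2} + v^{3/2})^{2/3} ≤ u + v`. [cite: BoydVandenberghe2004, §9.6.2 "Sum"] -/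
theorem mul_sqrt_add_mul_sqrt_le {u v : ℝ} (hu : 0 ≤ u) (hv : 0 ≤ v) :
    u * Real.sqrt u + v * Real.sqrt v ≤ (u + v) * Real.sqrt (u + v) := by
  have h1 : Real.sqrt u ≤ Real.sqrt (u + v) := Real.sqrt_le_sqrt (by linarith)
  have h2 : Real.sqrt v ≤ Real.sqrt (u + v) := Real.sqrt_le_sqrt (by linarith)
  calc u * Real.sqrt u + v * Real.sqrt v ≤ u * Real.sqrt (u + v) + v * Real.sqrt (u + v) := by
        gcongr
    _ = (u + v) * Real.sqrt (u + v) := by ring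

namespace SelfConcordantWith

variable {s t : Set ℝ} {f f₁ f₂ f₃ g g₁ g₂ g₃ : ℝ → ℝ} {x : ℝ}

/-- **Scaling.** If `f` is self-concordant and `a ≥ 1` then `a f` is self-concordant.
[cite: BoydVandenberghe2004, §9.6.2 "Scaling and sum"] -/
theorem const_mul (h : SelfConcordantWith s f f₁ f₂ f₃) {a : ℝ} (ha : 1 ≤ a) :
    SelfConcordantWith s (fun x => a * f x) (fun x => a * f₁ x) (fun x => a * f₂ x)
      (fun x => a * f₃ x) where
  isOpen := h.isOpen
  hasDerivAt₁ x hx := (h.hasDerivAt₁ x hx).const_mul a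
  hasDerivAt₂ x hx := (h.hasDerivAt₂ x hx).const_mul a
  hasDerivAt₃ x hx := (h.hasDerivAt₃ x hx).const_mul a
  nonneg x hx := mul_nonneg (by linarith) (h.nonneg x hx)
  abs_le x hx := by
    have ha0 : 0 ≤ a := by linarith
    have hf2 := h.nonneg x hx
    have hsq : Real.sqrt (f₂ x) ≤ Real.sqrt (a * f₂ x) := Real.sqrt_le_sqrt (by nlinarith)
    rw [abs_mul, abs_of_nonneg ha0]
    calc a * |f₃ x| ≤ a * (2 * (f₂ x * Real.sqrt (f₂ x))) := by gcongr; exact h.abs_le x hx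
      _ ≤ a * (2 * (f₂ x * Real.sqrt (a * f₂ x))) := by gcongr
      _ = 2 * (a * f₂ x * Real.sqrt (a * f₂ x)) := by ring

/-- **Sum.** If `f, g` are self-concordant on `s` then so is `f + g`.
[cite: BoydVandenberghe2004, §9.6.2 "Scaling and sum"] -/
theorem add (hf : SelfConcordantWith s f f₁ f₂ f₃) (hg : SelfConcordantWith s g g₁ g₂ g₃) :
    SelfConcordantWith s (fun x => f x + g x) (fun x => f₁ x + g₁ x) (fun x => f₂ x + g₂ x)
      (fun x => f₃ x + g₃ x) where
  isOpen := hf.isOpen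
  hasDerivAt₁ x hx := (hf.hasDerivAt₁ x hx).add (hg.hasDerivAt₁ x hx)
  hasDerivAt₂ x hx := (hf.hasDerivAt₂ x hx).add (hg.hasDerivAt₂ x hx)
  hasDerivAt₃ x hx := (hf.hasDerivAt₃ x hx).add (hg.hasDerivAt₃ x hx)
  nonneg x hx := add_nonneg (hf.nonneg x hx) (hg.nonneg x hx)
  abs_le x hx := by
    have key := mul_sqrt_add_mul_sqrt_le (hf.nonneg x hx) (hg.nonneg x hx)
    calc |f₃ x + g₃ x| ≤ |f₃ x| + |g₃ x| := abs_add_le _ _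
      _ ≤ 2 * (f₂ x * Real.sqrt (f₂ x)) + 2 * (g₂ x * Real.sqrt (g₂ x)) :=
          add_le_add (hf.abs_le x hx) (hg.abs_le x hx)
      _ ≤ 2 * ((f₂ x + g₂ x) * Real.sqrt (f₂ x + g₂ x)) := by linarith

/-- Sum of self-concordant functions given on different open sets, on the intersection.
[cite: BoydVandenberghe2004, §9.6.2 "Scaling and sum"] -/
theorem add_inter (hf : SelfConcordantWith s f f₁ f₂ f₃) (hg : SelfConcordantWith t g g₁ g₂ g₃) :
    SelfConcordantWith (s ∩ t) (fun x => f x + g x) (fun x => f₁ x + g₁ x) (fun x => f₂ x + g₂ x)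
      (fun x => f₃ x + g₃ x) :=
  (hf.mono (hf.isOpen.inter hg.isOpen) inter_subset_left).add
    (hg.mono (hf.isOpen.inter hg.isOpen) inter_subset_right)

/-- Finite sums of self-concordant functions are self-concordant.
[cite: BoydVandenberghe2004, §9.6.2 "Scaling and sum"] -/
theorem sum {ι : Type*} (S : Finset ι) {F F₁ F₂ F₃ : ι → ℝ → ℝ} (hs : IsOpen s)
    (h : ∀ i ∈ S, SelfConcordantWith s (F i) (F₁ i) (F₂ i) (F₃ i)) :
    SelfConcordantWith s (fun x => ∑ i ∈ S, F i x) (fun x => ∑ i ∈ S, F₁ i x)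
      (fun x => ∑ i ∈ S, F₂ i x) (fun x => ∑ i ∈ S, F₃ i x) := by
  classical
  induction S using Finset.induction_on with
  | empty => simpa using selfConcordantWith_const hs 0
  | insert a S ha ih =>
    simp only [Finset.sum_insert ha]
    exact (h a (Finset.mem_insert_self a S)).add
      (ih fun i hi => h i (Finset.mem_insert_of_mem hi))

/-- **Composition with an affine map.** If `f` is self-concordant on `s` then
`y ↦ f (a y + b)` is self-concordant on the preimage `{y | a y + b ∈ s}`, with derivatives
`a f'(a y + b)`, `a² f''(a y + b)`, `a³ f'''(a y + b)`.
[cite: BoydVandenberghe2004, §9.6.1 (affine invariance) and §9.6.2 "Composition"] -/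
theorem comp_affine (h : SelfConcordantWith s f f₁ f₂ f₃) (a b : ℝ) :
    SelfConcordantWith ((fun y => a * y + b) ⁻¹' s) (fun y => f (a * y + b))
      (fun y => a * f₁ (a * y + b)) (fun y => a ^ 2 * f₂ (a * y + b))
      (fun y => a ^ 3 * f₃ (a * y + b)) where
  isOpen := h.isOpen.preimage (by fun_prop)
  hasDerivAt₁ y hy := by
    have hl : HasDerivAt (fun y => a * y + b) a y :=
      (((hasDerivAt_id y).const_mul a).add_const b).congr_deriv (by simp)
    exact ((h.hasDerivAt₁ _ hy).comp y hl).congr_deriv (by ring)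
  hasDerivAt₂ y hy := by
    have hl : HasDerivAt (fun y => a * y + b) a y :=
      (((hasDerivAt_id y).const_mul a).add_const b).congr_deriv (by simp)
    exact (((h.hasDerivAt₂ _ hy).comp y hl).const_mul a).congr_deriv (by ring)
  hasDerivAt₃ y hy := by
    have hl : HasDerivAt (fun y => a * y + b) a y :=
      (((hasDerivAt_id y).const_mul a).add_const b).congr_deriv (by simp)
    exact (((h.hasDerivAt₃ _ hy).comp y hl).const_mul (a ^ 2)).congr_deriv (by ring)
  nonneg y hy := mul_nonneg (sq_nonneg a) (h.nonneg _ hy)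
  abs_le y hy := by
    have hf2 := h.nonneg _ hy
    have hsq : Real.sqrt (a ^ 2 * f₂ (a * y + b)) = |a| * Real.sqrt (f₂ (a * y + b)) := by
      rw [Real.sqrt_mul (sq_nonneg a), Real.sqrt_sq_eq_abs]
    rw [hsq, abs_mul, abs_pow]
    calc |a| ^ 3 * |f₃ (a * y + b)|
        ≤ |a| ^ 3 * (2 * (f₂ (a * y + b) * Real.sqrt (f₂ (a * y + b)))) := by
          gcongr; exact h.abs_le _ hy
      _ = 2 * (a ^ 2 * f₂ (a * y + b) * (|a| * Real.sqrt (f₂ (a * y + b)))) := by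
          rw [← sq_abs a]; ring

end SelfConcordantWith

/-- **General self-concordance constant (Boyd–Vandenberghe (9.42)).** If
`|f'''| ≤ k (f'')^{3/2}` on `s` for some constant `k ≥ 0`, then `(k²/4) f` is self-concordant
(the inequality becomes (9.41) with equality of constants).
[cite: BoydVandenberghe2004, §9.6.1 (9.42)] -/
theorem selfConcordantWith_const_mul_of_abs_le {s : Set ℝ} {f f₁ f₂ f₃ : ℝ → ℝ} (hs : IsOpen s)
    (h₁ : ∀ x ∈ s, HasDerivAt f (f₁ x) x) (h₂ : ∀ x ∈ s, HasDerivAt f₁ (f₂ x) x)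
    (h₃ : ∀ x ∈ s, HasDerivAt f₂ (f₃ x) x) (h0 : ∀ x ∈ s, 0 ≤ f₂ x) {k : ℝ} (hk : 0 ≤ k)
    (hle : ∀ x ∈ s, |f₃ x| ≤ k * (f₂ x * Real.sqrt (f₂ x))) :
    SelfConcordantWith s (fun x => k ^ 2 / 4 * f x) (fun x => k ^ 2 / 4 * f₁ x)
      (fun x => k ^ 2 / 4 * f₂ x) (fun x => k ^ 2 / 4 * f₃ x) where
  isOpen := hs
  hasDerivAt₁ x hx := (h₁ x hx).const_mul _
  hasDerivAt₂ x hx := (h₂ x hx).const_mul _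
  hasDerivAt₃ x hx := (h₃ x hx).const_mul _
  nonneg x hx := mul_nonneg (by positivity) (h0 x hx)
  abs_le x hx := by
    have hsq : Real.sqrt (k ^ 2 / 4 * f₂ x) = k / 2 * Real.sqrt (f₂ x) := by
      rw [Real.sqrt_mul' _ (h0 x hx), show k ^ 2 / 4 = (k / 2) ^ 2 by ring,
        Real.sqrt_sq (by positivity)]
    rw [hsq, abs_mul, abs_of_nonneg (by positivity)]
    calc k ^ 2 / 4 * |f₃ x| ≤ k ^ 2 / 4 * (k * (f₂ x * Real.sqrt (f₂ x))) := by
          gcongr; exact hle x hx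
      _ = 2 * (k ^ 2 / 4 * f₂ x * (k / 2 * Real.sqrt (f₂ x))) := by ring

namespace SelfConcordantOn

variable {s t : Set ℝ} {f g : ℝ → ℝ}

/-- [cite: BoydVandenberghe2004, §9.6.2 "Scaling and sum"] -/
theorem const_mul (h : SelfConcordantOn s f) {a : ℝ} (ha : 1 ≤ a) :
    SelfConcordantOn s fun x => a * f x := by
  obtain ⟨f₁, f₂, f₃, h⟩ := h; exact (h.const_mul ha).selfConcordantOn

/-- [cite: BoydVandenberghe2004, §9.6.2 "Scaling and sum"] -/
theorem add (hf : SelfConcordantOn s f) (hg : SelfConcordantOn t g) :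
    SelfConcordantOn (s ∩ t) fun x => f x + g x := by
  obtain ⟨f₁, f₂, f₃, hf⟩ := hf; obtain ⟨g₁, g₂, g₃, hg⟩ := hg
  exact (hf.add_inter hg).selfConcordantOn

/-- [cite: BoydVandenberghe2004, §9.6.2 "Composition"] -/
theorem comp_affine (h : SelfConcordantOn s f) (a b : ℝ) :
    SelfConcordantOn ((fun y => a * y + b) ⁻¹' s) fun y => f (a * y + b) := by
  obtain ⟨f₁, f₂, f₃, h⟩ := h; exact (h.comp_affine a b).selfConcordantOn

end SelfConcordantOn

/-! ## The logarithmic barrier (Boyd–Vandenberghe Example 9.4; Jarre–Vavasis (32.64)) -/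

/-- **Log barrier along a line (Boyd–Vandenberghe Example 9.4, one-dimensional form).**
`t ↦ -∑ᵢ log (bᵢ - aᵢ t)` is self-concordant on `{t | aᵢ t < bᵢ for all i}`.
[cite: BoydVandenberghe2004, Example 9.4] -/
theorem selfConcordantOn_logBarrier {ι : Type*} [Fintype ι] (a b : ι → ℝ) :
    SelfConcordantOn {t : ℝ | ∀ i, a i * t < b i} (fun t => -∑ i, Real.log (b i - a i * t)) := by
  set s : Set ℝ := {t : ℝ | ∀ i, a i * t < b i} with hs_def
  have hs : IsOpen s := by
    rw [hs_def, Set.setOf_forall]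
    exact isOpen_iInter_of_finite fun i => isOpen_lt (by fun_prop) (by fun_prop)
  -- each term `-log (-aᵢ t + bᵢ)` is self-concordant on `s ⊆ {t | 0 < -aᵢ t + bᵢ}`
  have hterm : ∀ i ∈ (Finset.univ : Finset ι),
      SelfConcordantWith s (fun t => -Real.log (-a i * t + b i))
        (fun t => -a i * -(-a i * t + b i)⁻¹) (fun t => (-a i) ^ 2 * ((-a i * t + b i) ^ 2)⁻¹)
        (fun t => (-a i) ^ 3 * (-2 / (-a i * t + b i) ^ 3)) := by
    intro i _
    refine (selfConcordantWith_neg_log.comp_affine (-a i) (b i)).mono hs ?_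
    intro t ht
    have := ht i
    show 0 < -a i * t + b i
    linarith
  have hsum := SelfConcordantWith.sum Finset.univ hs hterm
  have hfun : (fun t => -∑ i, Real.log (b i - a i * t)) =
      fun t => ∑ i, -Real.log (-a i * t + b i) := by
    funext t
    rw [← Finset.sum_neg_distrib]
    refine Finset.sum_congr rfl fun i _ => ?_
    rw [show b i - a i * t = -a i * t + b i by ring]
  rw [hfun]
  exact hsum.selfConcordantOn

section Line

variable {E : Type*} [AddCommGroup E] [Module ℝ E]

/-- Self-concordance on a subset of a real vector space, *along lines*: for every `x ∈ D` and
every direction `v`, the restriction `t ↦ F (x + t v)` is self-concordant on the (open) set of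
parameters `{t | x + t v ∈ D}`. This is Boyd–Vandenberghe's definition of self-concordance for
`f : ℝⁿ → ℝ`. [cite: BoydVandenberghe2004, §9.6.1 (p. 498)] -/
def LineSelfConcordantOn (D : Set E) (F : E → ℝ) : Prop :=
  ∀ x ∈ D, ∀ v : E, SelfConcordantOn {t : ℝ | x + t • v ∈ D} (fun t => F (x + t • v))

/-- **Boyd–Vandenberghe Example 9.4 (log barrier for linear inequalities).**
`F(x) = -∑ᵢ log (bᵢ - aᵢ(x))`, for linear functionals `aᵢ`, is self-concordant along every line of
the open polyhedron `{x | aᵢ(x) < bᵢ for all i}`. [cite: BoydVandenberghe2004, Example 9.4] -/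
theorem lineSelfConcordantOn_logBarrier {ι : Type*} [Fintype ι] (a : ι → E →ₗ[ℝ] ℝ)
    (b : ι → ℝ) :
    LineSelfConcordantOn {x : E | ∀ i, a i x < b i} (fun x => -∑ i, Real.log (b i - a i x)) := by
  intro x _ v
  have hset : {t : ℝ | x + t • v ∈ {x : E | ∀ i, a i x < b i}} =
      {t : ℝ | ∀ i, a i v * t < b i - a i x} := by
    ext t
    simp only [Set.mem_setOf_eq, map_add, map_smul, smul_eq_mul]
    refine forall_congr' fun i => ?_
    constructor <;> intro h <;> linarith
  have hfun : (fun t : ℝ => -∑ i, Real.log (b i - a i (x + t • v))) =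
      fun t => -∑ i, Real.log ((b i - a i x) - a i v * t) := by
    funext t
    simp only [map_add, map_smul, smul_eq_mul]
    congr 1
    refine Finset.sum_congr rfl fun i _ => ?_
    ring_nf
  show SelfConcordantOn {t : ℝ | x + t • v ∈ {x : E | ∀ i, a i x < b i}}
    (fun t : ℝ => -∑ i, Real.log (b i - a i (x + t • v)))
  rw [hset, hfun]
  exact selfConcordantOn_logBarrier (fun i => a i v) (fun i => b i - a i x)

/-- **The logarithmic barrier of the positive orthant (Jarre–Vavasis (32.64)).**
`F(x) = -∑ᵢ log xᵢ` is self-concordant along every line of `{x | xᵢ > 0 for all i}`.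
[cite: JarreVavasis2009, §32.5 (32.64)] [cite: BoydVandenberghe2004, Example 9.4] -/
theorem lineSelfConcordantOn_negSumLog_orthant {ι : Type*} [Fintype ι] :
    LineSelfConcordantOn {x : ι → ℝ | ∀ i, 0 < x i} (fun x => -∑ i, Real.log (x i)) := by
  intro x _ v
  have hset : {t : ℝ | x + t • v ∈ {x : ι → ℝ | ∀ i, 0 < x i}} =
      {t : ℝ | ∀ i, (-v i) * t < x i} := by
    ext t
    simp only [Set.mem_setOf_eq, Pi.add_apply, Pi.smul_apply, smul_eq_mul]
    refine forall_congr' fun i => ?_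
    constructor <;> intro h <;> linarith
  have hfun : (fun t : ℝ => -∑ i, Real.log ((x + t • v) i)) =
      fun t => -∑ i, Real.log (x i - (-v i) * t) := by
    funext t
    simp only [Pi.add_apply, Pi.smul_apply, smul_eq_mul]
    congr 1
    refine Finset.sum_congr rfl fun i _ => ?_
    ring_nf
  show SelfConcordantOn {t : ℝ | x + t • v ∈ {x : ι → ℝ | ∀ i, 0 < x i}}
    (fun t : ℝ => -∑ i, Real.log ((x + t • v) i))
  rw [hset, hfun]
  exact selfConcordantOn_logBarrier (fun i => -v i) x

/-- **Log-determinant barrier (Boyd–Vandenberghe Example 9.5; Jarre–Vavasis §32.6;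
Nesterov–Nemirovski 1994): statement only.** `X ↦ -log det X` is self-concordant along every line
of the positive definite cone. Recorded as a named `Prop` (to be used as a hypothesis
`(h : NegLogDetLineSelfConcordant n)`); the eigenvalue reduction of Example 9.5 is *not* formalised
in this file. [cite: BoydVandenberghe2004, Example 9.5] -/
def NegLogDetLineSelfConcordant (n : Type*) [Fintype n] [DecidableEq n] : Prop :=
  LineSelfConcordantOn {X : Matrix n n ℝ | X.PosDef} (fun X => -Real.log X.det)

end Line

/-! ## Bounds on the second derivative (Boyd–Vandenberghe §9.6.3, (9.45)–(9.46)) -/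

namespace SelfConcordantWith

variable {s : Set ℝ} {f f₁ f₂ f₃ : ℝ → ℝ} {x : ℝ}

/-- At a point where `f'' > 0`, `τ ↦ f''(τ)^{-1/2}` has derivative `-f'''/(2 (f'')^{3/2})`.
[cite: BoydVandenberghe2004, §9.6.3 (display before (9.45))] -/
theorem hasDerivAt_inv_sqrt (h : SelfConcordantWith s f f₁ f₂ f₃) (hx : x ∈ s) (hpos : 0 < f₂ x) :
    HasDerivAt (fun τ => (Real.sqrt (f₂ τ))⁻¹) (-(f₃ x) / (2 * (f₂ x * Real.sqrt (f₂ x)))) x := by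
  have hsq : Real.sqrt (f₂ x) ≠ 0 := Real.sqrt_ne_zero'.mpr hpos
  refine (((h.hasDerivAt₃ x hx).sqrt hpos.ne').inv hsq).congr_deriv ?_
  rw [Real.sq_sqrt hpos.le]
  field_simp

/-- **Boyd–Vandenberghe (9.45), pointwise form.** `|d/dt f''(t)^{-1/2}| ≤ 1` wherever `f'' > 0`.
[cite: BoydVandenberghe2004, §9.6.3 (9.45)] -/
theorem abs_deriv_inv_sqrt_le_one (h : SelfConcordantWith s f f₁ f₂ f₃) (hx : x ∈ s)
    (hpos : 0 < f₂ x) : |-(f₃ x) / (2 * (f₂ x * Real.sqrt (f₂ x)))| ≤ 1 := by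
  have hsp : 0 < Real.sqrt (f₂ x) := Real.sqrt_pos.mpr hpos
  have hden : 0 < 2 * (f₂ x * Real.sqrt (f₂ x)) := by nlinarith [mul_pos hpos hsp]
  rw [abs_div, abs_neg, abs_of_pos hden, div_le_one hden]
  exact h.abs_le x hx

/-- **Boyd–Vandenberghe (9.45), integrated.** If `f` is self-concordant with `f'' > 0` on a segment
`[t₀, t₁] ⊆ s`, then `|f''(t₁)^{-1/2} - f''(t₀)^{-1/2}| ≤ t₁ - t₀`.
[cite: BoydVandenberghe2004, §9.6.3 (9.45)] -/
theorem abs_inv_sqrt_sub_inv_sqrt_le (h : SelfConcordantWith s f f₁ f₂ f₃) {t₀ t₁ : ℝ}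
    (ht : t₀ ≤ t₁) (hI : Icc t₀ t₁ ⊆ s) (hpos : ∀ τ ∈ Icc t₀ t₁, 0 < f₂ τ) :
    |(Real.sqrt (f₂ t₁))⁻¹ - (Real.sqrt (f₂ t₀))⁻¹| ≤ t₁ - t₀ := by
  have hderiv : ∀ τ ∈ Icc t₀ t₁, HasDerivWithinAt (fun τ => (Real.sqrt (f₂ τ))⁻¹)
      (-(f₃ τ) / (2 * (f₂ τ * Real.sqrt (f₂ τ)))) (Icc t₀ t₁) τ :=
    fun τ hτ => (h.hasDerivAt_inv_sqrt (hI hτ) (hpos τ hτ)).hasDerivWithinAt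
  have hbound : ∀ τ ∈ Ico t₀ t₁, ‖-(f₃ τ) / (2 * (f₂ τ * Real.sqrt (f₂ τ)))‖ ≤ 1 := by
    intro τ hτ
    rw [Real.norm_eq_abs]
    exact h.abs_deriv_inv_sqrt_le_one (hI (Ico_subset_Icc_self hτ))
      (hpos τ (Ico_subset_Icc_self hτ))
  have key := norm_image_sub_le_of_norm_deriv_le_segment' hderiv hbound t₁ (right_mem_Icc.mpr ht)
  rw [Real.norm_eq_abs, one_mul] at key
  exact key

/-- **Boyd–Vandenberghe (9.46), lower bound.** Under the hypotheses of (9.45),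
`f''(t₁) ≥ f''(t₀) / (1 + (t₁ - t₀) f''(t₀)^{1/2})²`.
[cite: BoydVandenberghe2004, §9.6.3 (9.46)] -/
theorem deriv2_lower_bound (h : SelfConcordantWith s f f₁ f₂ f₃) {t₀ t₁ : ℝ} (ht : t₀ ≤ t₁)
    (hI : Icc t₀ t₁ ⊆ s) (hpos : ∀ τ ∈ Icc t₀ t₁, 0 < f₂ τ) :
    f₂ t₀ / (1 + (t₁ - t₀) * Real.sqrt (f₂ t₀)) ^ 2 ≤ f₂ t₁ := by
  have hb := h.abs_inv_sqrt_sub_inv_sqrt_le ht hI hpos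
  have h0 : 0 < f₂ t₀ := hpos t₀ (left_mem_Icc.mpr ht)
  have h1 : 0 < f₂ t₁ := hpos t₁ (right_mem_Icc.mpr ht)
  have s0 : 0 < Real.sqrt (f₂ t₀) := Real.sqrt_pos.mpr h0
  have s1 : 0 < Real.sqrt (f₂ t₁) := Real.sqrt_pos.mpr h1
  have hd0 : 0 ≤ t₁ - t₀ := by linarith
  have hle : (Real.sqrt (f₂ t₁))⁻¹ ≤ (Real.sqrt (f₂ t₀))⁻¹ + (t₁ - t₀) := by
    have := (_root_.abs_le.mp hb).2; linarith
  have key : Real.sqrt (f₂ t₀) ≤ Real.sqrt (f₂ t₁) * (1 + (t₁ - t₀) * Real.sqrt (f₂ t₀)) := by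
    calc Real.sqrt (f₂ t₀)
        = (Real.sqrt (f₂ t₀) * Real.sqrt (f₂ t₁)) * (Real.sqrt (f₂ t₁))⁻¹ := by field_simp
      _ ≤ (Real.sqrt (f₂ t₀) * Real.sqrt (f₂ t₁)) * ((Real.sqrt (f₂ t₀))⁻¹ + (t₁ - t₀)) := by
          gcongr
      _ = Real.sqrt (f₂ t₁) * (1 + (t₁ - t₀) * Real.sqrt (f₂ t₀)) := by field_simp
  have key2 : f₂ t₀ ≤ f₂ t₁ * (1 + (t₁ - t₀) * Real.sqrt (f₂ t₀)) ^ 2 := by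
    have hm := mul_self_le_mul_self s0.le key
    rw [Real.mul_self_sqrt h0.le] at hm
    calc f₂ t₀ ≤ _ := hm
      _ = f₂ t₁ * (1 + (t₁ - t₀) * Real.sqrt (f₂ t₀)) ^ 2 := by
          rw [mul_mul_mul_comm, Real.mul_self_sqrt h1.le]; ring
  rw [div_le_iff₀ (by positivity)]
  exact key2

/-- **Boyd–Vandenberghe (9.46), upper bound.** Under the hypotheses of (9.45) and for
`(t₁ - t₀) f''(t₀)^{1/2} < 1`, `f''(t₁) ≤ f''(t₀) / (1 - (t₁ - t₀) f''(t₀)^{1/2})²`.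
[cite: BoydVandenberghe2004, §9.6.3 (9.46)] -/
theorem deriv2_upper_bound (h : SelfConcordantWith s f f₁ f₂ f₃) {t₀ t₁ : ℝ} (ht : t₀ ≤ t₁)
    (hI : Icc t₀ t₁ ⊆ s) (hpos : ∀ τ ∈ Icc t₀ t₁, 0 < f₂ τ)
    (hd : (t₁ - t₀) * Real.sqrt (f₂ t₀) < 1) :
    f₂ t₁ ≤ f₂ t₀ / (1 - (t₁ - t₀) * Real.sqrt (f₂ t₀)) ^ 2 := by
  have hb := h.abs_inv_sqrt_sub_inv_sqrt_le ht hI hpos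
  have h0 : 0 < f₂ t₀ := hpos t₀ (left_mem_Icc.mpr ht)
  have h1 : 0 < f₂ t₁ := hpos t₁ (right_mem_Icc.mpr ht)
  have s0 : 0 < Real.sqrt (f₂ t₀) := Real.sqrt_pos.mpr h0
  have s1 : 0 < Real.sqrt (f₂ t₁) := Real.sqrt_pos.mpr h1
  have hm : 0 < 1 - (t₁ - t₀) * Real.sqrt (f₂ t₀) := by linarith
  have hge : (Real.sqrt (f₂ t₀))⁻¹ - (t₁ - t₀) ≤ (Real.sqrt (f₂ t₁))⁻¹ := by
    have := (_root_.abs_le.mp hb).1; linarith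
  have key : Real.sqrt (f₂ t₁) * (1 - (t₁ - t₀) * Real.sqrt (f₂ t₀)) ≤ Real.sqrt (f₂ t₀) := by
    calc Real.sqrt (f₂ t₁) * (1 - (t₁ - t₀) * Real.sqrt (f₂ t₀))
        = (Real.sqrt (f₂ t₀) * Real.sqrt (f₂ t₁)) * ((Real.sqrt (f₂ t₀))⁻¹ - (t₁ - t₀)) := by
          field_simp
      _ ≤ (Real.sqrt (f₂ t₀) * Real.sqrt (f₂ t₁)) * (Real.sqrt (f₂ t₁))⁻¹ := by gcongr
      _ = Real.sqrt (f₂ t₀) := by field_simp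
  have key2 : f₂ t₁ * (1 - (t₁ - t₀) * Real.sqrt (f₂ t₀)) ^ 2 ≤ f₂ t₀ := by
    have hm2 := mul_self_le_mul_self (by positivity) key
    rw [Real.mul_self_sqrt h0.le] at hm2
    calc f₂ t₁ * (1 - (t₁ - t₀) * Real.sqrt (f₂ t₀)) ^ 2
        = Real.sqrt (f₂ t₁) * (1 - (t₁ - t₀) * Real.sqrt (f₂ t₀)) *
            (Real.sqrt (f₂ t₁) * (1 - (t₁ - t₀) * Real.sqrt (f₂ t₀))) := by
          rw [mul_mul_mul_comm, Real.mul_self_sqrt h1.le]; ring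
      _ ≤ f₂ t₀ := hm2
  rw [le_div_iff₀ (by positivity)]
  exact key2

end SelfConcordantWith

end Literature.Analysis.Convex.SelfConcordant
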